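import Summits.ResolutionOfSingularities.ResolutionOfSingularities.Theorems.FrobeniusClosingSteerJacobianCriterionFormal
import Literature.RingTheory.MvPowerSeries.FiniteColength
import HarnessLib

/-!
# Crux `Steer` (stmt-ResolutionOfSingularities-16345), chain W4.1, K-side R3c: THE JACOBIAN CRITERION IN `IsolD` CURRENCY
# (finite colength of the Jacobian ideal ⟺ isolated singularity of the `p`-radicand germ; Theses-free, definition-free)

OURS (campaign `res-hironaka`, rung L ★L-G4, slot W4.1; seat res-D-pv-004 AS res-L0-w41-stub-10; replaces the role of
no printed item and is NOT a statement of the manuscript under review [claim: Hironaka2017, status: under-review];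
AI-produced, weaker than expert review). Sequel of `FrobeniusClosingSteerJacobianCriterionFormal.lean` (p511731) in the
literal currency of res-L0-w41-idea-1's `IsolD p n κ e D c := Module.Finite κ (κ⟦X⟧ ⧸ jac⁺)`,
`jac⁺ = span (range ∂_i a ∪ range D̃_l a)` (Sketch v6.1 §1/§8):

* `finite_quotient_iff_forall_isPrime` — for an ideal `J` of `S = κ⟦X₁, …, Xₙ⟧`: `S ⧸ J` finite over `κ` iff every prime
  containing `J` is `𝔪` (tree `Jets.exists_maximalIdeal_pow_le_of_finite_quotient`, `Jets.finite_quotient_maximalIdeal_pow`);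
  `finite_quotient_span_iff` — the two-family span form.
* **`isolated_iff_finite_quotient_jacobian`** — for a `p`-basis-dual frame `(γ, D)` of `κ` (char `p`) and `f ∈ S`:
  `HasIsolatedSingularity (S[T]/(T^p − f))` (unfolded) ⟺
  `Module.Finite κ (S ⧸ span (range (∂f/∂X_i) ∪ range (D̃_l f)))`.

[cite: Matsumura1987, Thm. 30.10]; Greuel–Lossen–Shustin 2007 §I.1.2–I.1.3 for the finite-colength facts. bears_on: LADDER-RESOLUTION L ★L-G4 W4.1.
-/

noncomputable section

set_option linter.dupNamespace false

open IsLocalRing MvPowerSeries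

namespace Summit.ResolutionOfSingularities.ResolutionOfSingularities.Theorems.SwitchingDichotomy.JacobianCriterionFormal

open Literature.AlgebraicGeometry.Resolution Literature.RingTheory.Derivation Literature.FieldTheory.Separability
open Literature.RingTheory.MvPowerSeries.Jets

universe u

variable {κ : Type u} [Field κ] {n : ℕ}

/-- **Finite colength ⟺ `𝔪`-primary, prime-wise**: for an ideal `J` of `S = κ⟦X₁, …, Xₙ⟧`, `S ⧸ J` is a
finite-dimensional `κ`-vector space iff every prime ideal containing `J` is the maximal ideal (iff `J` lies in no
non-maximal prime). (`⇒`: `𝔪^M ≤ J`, tree `Jets.exists_maximalIdeal_pow_le_of_finite_quotient`; `⇐`: `√J ⊇ 𝔪`, so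
`𝔪^M ≤ J` for some `M` and `S ⧸ J` is a quotient of the finite-dimensional `S ⧸ 𝔪^M`, tree
`Jets.finite_quotient_maximalIdeal_pow`.) [folklore] -/
theorem finite_quotient_iff_forall_isPrime (J : Ideal (MvPowerSeries (Fin n) κ)) :
    Module.Finite κ (MvPowerSeries (Fin n) κ ⧸ J) ↔
      ∀ (Q : Ideal (MvPowerSeries (Fin n) κ)) [Q.IsPrime], J ≤ Q → Q = maximalIdeal (MvPowerSeries (Fin n) κ) := by
  constructor
  · intro hfin Q _ hJQ
    obtain ⟨M, hM⟩ := exists_maximalIdeal_pow_le_of_finite_quotient J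
    have hle : maximalIdeal (MvPowerSeries (Fin n) κ) ≤ Q := by
      have h := hM.trans hJQ
      by_cases hM0 : M = 0
      · subst hM0
        rw [pow_zero, Ideal.one_eq_top, top_le_iff] at h
        exact absurd h (Ideal.IsPrime.ne_top inferInstance)
      · exact (Ideal.IsPrime.pow_le_iff hM0).mp h
    exact ((IsLocalRing.maximalIdeal.isMaximal _).eq_of_le (Ideal.IsPrime.ne_top inferInstance) hle).symm
  · intro hJ
    by_cases hJtop : J = ⊤
    · subst hJtop
      haveI : Subsingleton (MvPowerSeries (Fin n) κ ⧸ (⊤ : Ideal (MvPowerSeries (Fin n) κ))) :=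
        Ideal.Quotient.subsingleton_iff.mpr rfl
      exact Module.Finite.of_surjective (0 : κ →ₗ[κ] MvPowerSeries (Fin n) κ ⧸ (⊤ : Ideal _))
        (fun x => ⟨0, Subsingleton.elim _ _⟩)
    · -- `𝔪 ≤ √J`
      have hrad : maximalIdeal (MvPowerSeries (Fin n) κ) ≤ J.radical := by
        intro x hx
        rw [Ideal.radical_eq_sInf, Submodule.mem_sInf]
        rintro P ⟨hJP, hP⟩
        haveI := hP
        rw [hJ P hJP]
        exact hx
      haveI := isRegularLocalRing_mvPowerSeries κ (Fin n)
      obtain ⟨M, hM⟩ := Ideal.exists_pow_le_of_le_radical_of_fg hrad (IsNoetherian.noetherian _)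
      haveI := finite_quotient_maximalIdeal_pow (σ := Fin n) (K := κ) M
      exact Module.Finite.of_surjective
        (Ideal.Quotient.factorₐ κ hM).toLinearMap (Ideal.Quotient.factor_surjective hM)

/-- **`J` in no non-maximal prime ⟺ finite colength**, for the Jacobian-type ideal generated by two families
(the shape of res-L0-w41-idea-1's `jacD` / `IsolD`). [folklore] -/
theorem finite_quotient_span_iff {ι ι' : Type*} (a : ι → MvPowerSeries (Fin n) κ) (b : ι' → MvPowerSeries (Fin n) κ) :
    Module.Finite κ (MvPowerSeries (Fin n) κ ⧸ Ideal.span (Set.range a ∪ Set.range b)) ↔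
      ∀ (Q : Ideal (MvPowerSeries (Fin n) κ)) [Q.IsPrime], Q ≠ maximalIdeal (MvPowerSeries (Fin n) κ) →
        (∃ i, a i ∉ Q) ∨ ∃ l, b l ∉ Q := by
  rw [finite_quotient_iff_forall_isPrime]
  constructor
  · intro h Q _ hQ
    by_contra hcon
    push Not at hcon
    apply hQ
    apply h Q
    rw [Ideal.span_le]
    rintro x (⟨i, rfl⟩ | ⟨l, rfl⟩)
    · exact hcon.1 i
    · exact hcon.2 l
  · intro h Q _ hJQ
    by_contra hQ
    rcases h Q hQ with ⟨i, hi⟩ | ⟨l, hl⟩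
    · exact hi (hJQ (Ideal.subset_span (Or.inl ⟨i, rfl⟩)))
    · exact hl (hJQ (Ideal.subset_span (Or.inr ⟨l, rfl⟩)))

variable (p : ℕ) [Fact p.Prime] [CharP κ p] {e : ℕ} (γ : Fin e → κ) (D : Fin e → Derivation ℤ κ κ)

/-- **THE JACOBIAN CRITERION in `IsolD` currency** (res-L0-w41-idea-1 Sketch v6.1 §8, with the dual-frame hypothesis):
for a `p`-basis-dual frame `(γ, D)` of `κ` and `f ∈ S = κ⟦X₁, …, Xₙ⟧`, the torsor germ `S[T]/(T^p − f)` has an isolated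
singularity iff `S ⧸ (∂f/∂X_i, D̃_l f)` is finite-dimensional over `κ` (finite colength of the Jacobian ideal).
[cite: Matsumura1987, Thm. 30.10 (Nagata's Jacobian criterion)] -/
theorem isolated_iff_finite_quotient_jacobian (hdual : ∀ l l', D l (γ l') = if l' = l then 1 else 0)
    (hgen : pAdjoin p (Set.range γ) = ⊤) (f : MvPowerSeries (Fin n) κ) :
    (∀ (P' : Ideal (AdjoinRoot ((Polynomial.X : Polynomial (MvPowerSeries (Fin n) κ)) ^ p - Polynomial.C f)))
      [P'.IsPrime], (∃ Q' : Ideal (AdjoinRoot ((Polynomial.X : Polynomial (MvPowerSeries (Fin n) κ)) ^ p -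
        Polynomial.C f)), Q'.IsPrime ∧ P' < Q') → IsRegularLocalRing (Localization.AtPrime P')) ↔
    Module.Finite κ (MvPowerSeries (Fin n) κ ⧸ Ideal.span
      (Set.range (fun i => MvPowerSeries.pderiv i f) ∪ Set.range (fun l => (D l).mvPowerSeriesCoeffwise f))) := by
  rw [finite_quotient_span_iff, isolated_iff_frame p γ D hdual hgen f]

end Summit.ResolutionOfSingularities.ResolutionOfSingularities.Theorems.SwitchingDichotomy.JacobianCriterionFormal

end
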